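import Summits.ValiantsHypothesis.ValiantsHypothesis.Theorems.LacunarySymmetroidMatrixDescartesCensusDoorA34EqualDiagonalChart

/-!
# `MatrixDescartes` census — DOOR A at `(3,4)`: the EQUAL-DIAGONAL CHART, part 2 — every real symmetric `(3,4)` net whose
# annihilator pencil is REALLY SPLIT is congruent to a signed-equal-diagonal net; the census count is a chart count

HONEST FRAMING.  Object-search cell `pub-symmetroid`, door-A seat `val-sym-door-p3` (g17); item stmt-ValiantsHypothesis-19980
`DoorA34 = PosRootLawAt 3 4 18` (route item `Theses.LacunarySymmetroid.DoorA34`) is OPEN and asserted nowhere in this file.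
Nothing here bounds `ζ_sym(3,4)`; nothing bears on `MatrixDescartes` (stmt-ValiantsHypothesis-18050) or on `VP ≠ VNP`.

CONTENT (all supports; no `def`, no `sorry`).  A four-letter net `span{S₀,…,S₃} ⊂ Sym₃(ℝ)` is cut out (trace pairing) by an
ANNIHILATOR PENCIL `(B₁, B₂)` of symmetric matrices; call it REALLY SPLIT when `det B₁ ≠ 0` and `det (B₂ − μB₁) = 0` has three
distinct real roots (the pencil of conics `{vᵀBv = 0}` has its three degenerate members at real parameters; node classes R4 / R0 of
`…NodeForm` / `…NodeFormComplex`; the complementary generic sector R2 has one real and two conjugate roots and is NOT treated here).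
* **`exists_congr_signedEqualDiag`** — THE CHART: for such a net there are ONE invertible `P`, FIXED signs `εᵢ ∈ {±1}` and reals
  `δ_l, α_l, β_l, γ_l` with `S_l = Pᵀ [[ε₀δ_l, α_l, β_l], [α_l, ε₁δ_l, γ_l], [β_l, γ_l, ε₂δ_l]] P` for EVERY letter `l` (proof:
  part 1's `exists_congr_diagonal_pair`, then the pulled-back diagonals are orthogonal to `a` and `μa`, hence on the line through
  `c = a × μa` with `cᵢ ≠ 0` — `diag_parallel` — and `diag(√|cᵢ|)` normalises); sixteen parameters, no residual gauge;
* `pencil_congr`, `card_posRoots_congr` (census currency, `det P·det Q ≠ 0`), **`card_posRoots_eq_signedEqualDiag`**: on every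
  exponent vector `d` the number of distinct positive det-roots of such a pencil EQUALS that of a signed-equal-diagonal pencil on `d`;
* **`card_posRoots_le_of_signedEqualDiag_rows`**: hence the Door-A row on the really-split sector follows from the rows of the
  sixteen-parameter chart family (`ε = (1,1,1)`: `det = δ³ − δ(α²+β²+γ²) + 2αβγ`, the `4`-nomial `−δ(t)` against the eigenvalue
  branches of the hollow matrix `A(t)`; `ε` mixed: `det = ε₀ε₁ε₂δ³ − δ(ε₀γ²+ε₁β²+ε₂α²) + 2αβγ`); conversely
  `signedEqualDiag_rows_of_posRootLawOn` / `signedEqualDiag_rows_of_doorA34` (chart pencils are symmetric pencils).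
What is NOT here: the R2 chart, the density of the really-split ∪ R2 sector and the openness of `Z₊ ≥ 19` in the letters — the three
inputs of a full «`DoorA34` ⟺ chart rows» equivalence.  [folklore] Simultaneous reduction of two real quadratic forms; elementary.
-/

-- `Summit.ValiantsHypothesis.ValiantsHypothesis.…` repeats a component by the D-0017 layout
-- (single-conjunct summit), which the `dupNamespace` linter flags; the name is mandated.
set_option linter.dupNamespace false

namespace Summit.ValiantsHypothesis.ValiantsHypothesis.Theorems.LacunarySymmetroidMatrixDescartes.Census.EqualDiagonal

open Polynomial Matrix Finset
open scoped BigOperators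

/-! ## 3. The chart theorem: nets with a really split annihilator pencil are congruent to signed-equal-diagonal nets -/

/-- Two diagonal linear conditions `∑ aᵢxᵢ = 0 = ∑ μᵢaᵢxᵢ` put `x` on the line spanned by
`c = (a₁a₂(μ₂−μ₁), a₂a₀(μ₀−μ₂), a₀a₁(μ₁−μ₀))` (the cross product of `a` and `(μᵢaᵢ)`). [folklore] -/
theorem diag_parallel (a μ x : Fin 3 → ℝ) (h1 : ∑ i, a i * x i = 0) (h2 : ∑ i, μ i * a i * x i = 0) :
    x 1 * (a 1 * a 2 * (μ 2 - μ 1)) = x 0 * (a 2 * a 0 * (μ 0 - μ 2)) ∧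
      x 2 * (a 1 * a 2 * (μ 2 - μ 1)) = x 0 * (a 0 * a 1 * (μ 1 - μ 0)) := by
  simp only [Fin.sum_univ_three] at h1 h2
  constructor
  · linear_combination (a 2 * μ 2) * h1 - (a 2) * h2
  · linear_combination (a 1) * h2 - (a 1 * μ 1) * h1

/-- **THE SIGNED EQUAL-DIAGONAL CHART** (classes R4 / R0 of the cell's node dictionary, ALL supports — no exponent enters).
Let `S₀,…,S₃` be real symmetric `3 × 3` letters annihilated (trace pairing) by two symmetric matrices `B₁, B₂` with `det B₁ ≠ 0`
and THREE DISTINCT REAL generalised eigenvalues (`det (B₂ − μᵢB₁) = 0`, `μ` injective).  Then ONE congruence `S_l = Pᵀ Y_l P`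
(`det P ≠ 0`, the same `P` for every letter) brings every letter to the form
`Y_l = [[ε₀δ_l, α_l, β_l], [α_l, ε₁δ_l, γ_l], [β_l, γ_l, ε₂δ_l]]` with FIXED signs `εᵢ ∈ {±1}`: equal diagonal up to sign.
(`ε` constant = class R4, four real nodes `P⁻¹(1,±1,±1)`; `ε` mixed = class R0.)  Proof: §2 diagonalises `(B₁,B₂)` to
`(diag a, diag μa)`; the pulled-back letters have diagonals orthogonal to `a` and `μa`, hence on the line `ℝ·c`
(`diag_parallel`; `cᵢ ≠ 0` because the `μᵢ` are distinct and the `aᵢ ≠ 0`), and the diagonal congruence `diag(√|cᵢ|)` normalises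
`|cᵢ| = 1`. [folklore] Simultaneous reduction of a pair of real quadratic forms; elementary. -/
theorem exists_congr_signedEqualDiag (S : Fin 4 → Matrix (Fin 3) (Fin 3) ℝ) (hS : ∀ l, (S l).IsSymm)
    (B₁ B₂ : Matrix (Fin 3) (Fin 3) ℝ) (hB₁ : B₁.IsSymm) (hB₂ : B₂.IsSymm) (hdet : B₁.det ≠ 0)
    (hann₁ : ∀ l, (B₁ * S l).trace = 0) (hann₂ : ∀ l, (B₂ * S l).trace = 0)
    (μ : Fin 3 → ℝ) (hμ : Function.Injective μ) (hroot : ∀ i, (B₂ - μ i • B₁).det = 0) :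
    ∃ (P : Matrix (Fin 3) (Fin 3) ℝ) (ε : Fin 3 → ℝ) (δ α β γ : Fin 4 → ℝ), P.det ≠ 0 ∧ (∀ i, ε i = 1 ∨ ε i = -1) ∧
      ∀ l, S l = Pᵀ * !![ε 0 * δ l, α l, β l; α l, ε 1 * δ l, γ l; β l, γ l, ε 2 * δ l] * P := by
  obtain ⟨V, hVdet, a, ha, hVB₁, hVB₂⟩ := exists_congr_diagonal_pair B₁ B₂ hB₁ hB₂ hdet μ hμ hroot
  have hVunit : IsUnit V.det := isUnit_iff_ne_zero.mpr hVdet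
  have hWV : V⁻¹ * V = 1 := Matrix.nonsing_inv_mul V hVunit
  -- pulled-back letters `X_l = V⁻ᵀ S_l V⁻¹`, so that `S_l = Vᵀ X_l V`
  set X : Fin 4 → Matrix (Fin 3) (Fin 3) ℝ := fun l => (V⁻¹)ᵀ * S l * V⁻¹ with hXdef
  have hSX : ∀ l, S l = Vᵀ * X l * V := by
    intro l
    calc S l = (V⁻¹ * V)ᵀ * S l * (V⁻¹ * V) := by rw [hWV, transpose_one, Matrix.one_mul, Matrix.mul_one]
      _ = Vᵀ * X l * V := by rw [hXdef, transpose_mul]; simp only [Matrix.mul_assoc]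
  -- the two diagonal conditions
  have htr : ∀ (B : Matrix (Fin 3) (Fin 3) ℝ) l, (V * B * Vᵀ * X l).trace = (B * S l).trace := by
    intro B l
    rw [hSX l]
    calc (V * B * Vᵀ * X l).trace = (V * (B * Vᵀ * X l)).trace := by simp only [Matrix.mul_assoc]
      _ = ((B * Vᵀ * X l) * V).trace := Matrix.trace_mul_comm _ _
      _ = (B * (Vᵀ * X l * V)).trace := by simp only [Matrix.mul_assoc]
  have hx₁ : ∀ l, ∑ i, a i * X l i i = 0 := fun l => by
    rw [← trace_diagonal_mul_three, ← hVB₁, htr, hann₁]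
  have hx₂ : ∀ l, ∑ i, μ i * a i * X l i i = 0 := fun l => by
    rw [← trace_diagonal_mul_three, ← hVB₂, htr, hann₂]
  -- the common direction of the diagonals
  set c : Fin 3 → ℝ := ![a 1 * a 2 * (μ 2 - μ 1), a 2 * a 0 * (μ 0 - μ 2), a 0 * a 1 * (μ 1 - μ 0)] with hcdef
  have hμne : ∀ i j : Fin 3, i ≠ j → μ i - μ j ≠ 0 := fun i j hij => sub_ne_zero.mpr fun h => hij (hμ h)
  have hc : ∀ i, c i ≠ 0 := by
    intro i
    fin_cases i
    · exact mul_ne_zero (mul_ne_zero (ha 1) (ha 2)) (hμne 2 1 (by decide))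
    · exact mul_ne_zero (mul_ne_zero (ha 2) (ha 0)) (hμne 0 2 (by decide))
    · exact mul_ne_zero (mul_ne_zero (ha 0) (ha 1)) (hμne 1 0 (by decide))
  have hpar : ∀ l i, X l i i * c 0 = X l 0 0 * c i := by
    intro l i
    obtain ⟨hA, hB⟩ := diag_parallel a μ (fun j => X l j j) (hx₁ l) (hx₂ l)
    fin_cases i
    · rfl
    · simpa [hcdef] using hA
    · simpa [hcdef] using hB
  set t : Fin 4 → ℝ := fun l => X l 0 0 / c 0 with htdef
  have hXdiag : ∀ l i, X l i i = t l * c i := by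
    intro l i
    have h := hpar l i
    rw [htdef, div_mul_eq_mul_div, eq_div_iff (hc 0), h]
  -- the normalising diagonal congruence
  set s : Fin 3 → ℝ := fun i => Real.sqrt |c i| with hsdef
  have hs : ∀ i, 0 < s i := fun i => Real.sqrt_pos.mpr (abs_pos.mpr (hc i))
  have hss : ∀ i, s i * s i = |c i| := fun i => Real.mul_self_sqrt (abs_nonneg _)
  set E : Matrix (Fin 3) (Fin 3) ℝ := diagonal s with hEdef
  set D : Matrix (Fin 3) (Fin 3) ℝ := diagonal (fun i => (s i)⁻¹) with hDdef
  have hED : E * D = 1 := by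
    rw [hEdef, hDdef, diagonal_mul_diagonal, ← diagonal_one]
    congr 1; funext i; exact mul_inv_cancel₀ (hs i).ne'
  have hDE : D * E = 1 := by
    rw [hEdef, hDdef, diagonal_mul_diagonal, ← diagonal_one]
    congr 1; funext i; exact inv_mul_cancel₀ (hs i).ne'
  set Y : Fin 4 → Matrix (Fin 3) (Fin 3) ℝ := fun l => D * X l * D with hYdef
  have hXY : ∀ l, X l = E * Y l * E := by
    intro l
    rw [hYdef]
    rw [show E * (D * X l * D) * E = (E * D) * X l * (D * E) by simp only [Matrix.mul_assoc], hED, hDE,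
      Matrix.one_mul, Matrix.mul_one]
  set P : Matrix (Fin 3) (Fin 3) ℝ := E * V with hPdef
  have hPdet : P.det ≠ 0 := by
    rw [hPdef, det_mul, hEdef, det_diagonal]
    exact mul_ne_zero (Finset.prod_ne_zero_iff.mpr fun i _ => (hs i).ne') hVdet
  have hSP : ∀ l, S l = Pᵀ * Y l * P := by
    intro l
    rw [hSX, hXY, hPdef, transpose_mul, hEdef, diagonal_transpose]
    simp only [Matrix.mul_assoc]
  -- the signs
  set ε : Fin 3 → ℝ := fun i => c i / |c i| with hεdef
  have hε : ∀ i, ε i = 1 ∨ ε i = -1 := by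
    intro i
    rcases lt_or_gt_of_ne (hc i) with h | h
    · right; rw [hεdef]; simp only; rw [abs_of_neg h, div_neg, div_self h.ne, eq_self_iff_true]; trivial
    · left; rw [hεdef]; simp only; rw [abs_of_pos h, div_self h.ne']
  -- entries of `Y`
  have hYdiag : ∀ l i, Y l i i = ε i * t l := by
    intro l i
    rw [hYdef]
    simp only
    rw [hDdef, mul_diagonal, diagonal_mul, hXdiag, hεdef]
    have hci : |c i| ≠ 0 := abs_ne_zero.mpr (hc i)
    have hsi : (s i) ≠ 0 := (hs i).ne'
    field_simp
    rw [sq, hss]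
    ring
  have hYsymm : ∀ l i j, Y l i j = Y l j i := by
    intro l i j
    have hT : (Y l)ᵀ = Y l := by
      rw [hYdef]
      simp only
      rw [transpose_mul, transpose_mul, hDdef, diagonal_transpose, hXdef, transpose_mul, transpose_mul,
        transpose_transpose, (hS l).eq]
      simp only [Matrix.mul_assoc]
    have h := congrFun (congrFun hT i) j
    rw [transpose_apply] at h
    exact h.symm
  refine ⟨P, ε, t, fun l => Y l 0 1, fun l => Y l 0 2, fun l => Y l 1 2, hPdet, hε, fun l => ?_⟩
  rw [hSP l]
  congr 2
  ext i j
  fin_cases i <;> fin_cases j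
  · simpa using hYdiag l 0
  · simp
  · simp
  · simpa using hYsymm l 1 0
  · simpa using hYdiag l 1
  · simp
  · simpa using hYsymm l 2 0
  · simpa using hYsymm l 2 1
  · simpa using hYdiag l 2

/-! ## 4. Root form: the census count is a chart count; the door on the really-split sector -/

/-- Congruence of a four-letter `3 × 3` lacunary pencil (census currency). [folklore] -/
theorem pencil_congr (d : Fin 4 → ℕ) (S : Fin 4 → Matrix (Fin 3) (Fin 3) ℝ) (P Q : Matrix (Fin 3) (Fin 3) ℝ) :
    (∑ l, ((X : ℝ[X]) ^ d l) • (P * S l * Q).map C) = P.map C * (∑ l, ((X : ℝ[X]) ^ d l) • (S l).map C) * Q.map C := by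
  rw [Finset.mul_sum, Finset.sum_mul]
  refine Finset.sum_congr rfl fun l _ => ?_
  rw [Matrix.map_mul, Matrix.map_mul, Matrix.mul_smul, Matrix.smul_mul]

/-- Congruent / equivalent four-letter pencils have the same number of distinct positive det-roots (`det P, det Q ≠ 0`). [folklore] -/
theorem card_posRoots_congr (d : Fin 4 → ℕ) (S : Fin 4 → Matrix (Fin 3) (Fin 3) ℝ) (P Q : Matrix (Fin 3) (Fin 3) ℝ)
    (hP : P.det ≠ 0) (hQ : Q.det ≠ 0) :
    ((Matrix.det (∑ l, ((X : ℝ[X]) ^ d l) • (P * S l * Q).map C)).roots.toFinset.filter (fun t => 0 < t)).card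
      = ((Matrix.det (∑ l, ((X : ℝ[X]) ^ d l) • (S l).map C)).roots.toFinset.filter (fun t => 0 < t)).card := by
  have hPC : (P.map C).det = C P.det := by rw [← RingHom.mapMatrix_apply, ← RingHom.map_det]
  have hQC : (Q.map C).det = C Q.det := by rw [← RingHom.mapMatrix_apply, ← RingHom.map_det]
  have hdet : (Matrix.det (∑ l, ((X : ℝ[X]) ^ d l) • (P * S l * Q).map C))
      = C (P.det * Q.det) * Matrix.det (∑ l, ((X : ℝ[X]) ^ d l) • (S l).map C) := by
    rw [pencil_congr, Matrix.det_mul, Matrix.det_mul, hPC, hQC, map_mul]; ring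
  rw [hdet, Polynomial.roots_C_mul _ (mul_ne_zero hP hQ)]

/-- **THE EQUAL-DIAGONAL CHART THEOREM, census form** (all supports).  On any exponent vector `d`, a real symmetric `(3,4)`
pencil whose net has a really split annihilator pencil (hypotheses of `exists_congr_signedEqualDiag`) has EXACTLY as many distinct
positive det-roots as some SIGNED EQUAL-DIAGONAL pencil `∑_l X^{d_l} [[ε₀δ_l, α_l, β_l], [α_l, ε₁δ_l, γ_l], [β_l, γ_l, ε₂δ_l]]` on the
same `d` (`εᵢ ∈ {±1}` fixed, sixteen real parameters `δ, α, β, γ : Fin 4 → ℝ`, no residual gauge). [folklore] -/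
theorem card_posRoots_eq_signedEqualDiag (d : Fin 4 → ℕ) (S : Fin 4 → Matrix (Fin 3) (Fin 3) ℝ) (hS : ∀ l, (S l).IsSymm)
    (B₁ B₂ : Matrix (Fin 3) (Fin 3) ℝ) (hB₁ : B₁.IsSymm) (hB₂ : B₂.IsSymm) (hdet : B₁.det ≠ 0)
    (hann₁ : ∀ l, (B₁ * S l).trace = 0) (hann₂ : ∀ l, (B₂ * S l).trace = 0)
    (μ : Fin 3 → ℝ) (hμ : Function.Injective μ) (hroot : ∀ i, (B₂ - μ i • B₁).det = 0) :
    ∃ (ε : Fin 3 → ℝ) (δ α β γ : Fin 4 → ℝ), (∀ i, ε i = 1 ∨ ε i = -1) ∧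
      ((Matrix.det (∑ l, ((X : ℝ[X]) ^ d l) • (S l).map C)).roots.toFinset.filter (fun t => 0 < t)).card
        = ((Matrix.det (∑ l, ((X : ℝ[X]) ^ d l) •
            (!![ε 0 * δ l, α l, β l; α l, ε 1 * δ l, γ l; β l, γ l, ε 2 * δ l] : Matrix (Fin 3) (Fin 3) ℝ).map C)).roots.toFinset.filter
              (fun t => 0 < t)).card := by
  obtain ⟨P, ε, δ, α, β, γ, hP, hε, hSP⟩ := exists_congr_signedEqualDiag S hS B₁ B₂ hB₁ hB₂ hdet hann₁ hann₂ μ hμ hroot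
  refine ⟨ε, δ, α, β, γ, hε, ?_⟩
  have hfun : S = fun l => Pᵀ * !![ε 0 * δ l, α l, β l; α l, ε 1 * δ l, γ l; β l, γ l, ε 2 * δ l] * P := funext hSP
  rw [hfun, card_posRoots_congr d _ Pᵀ P (by rwa [det_transpose]) hP]

/-- **THE DOOR ON THE REALLY-SPLIT SECTOR REDUCES TO SIXTEEN-PARAMETER CHART ROWS.**  If on the exponent vector `d` every signed
equal-diagonal pencil has `≤ 18` distinct positive det-roots, then so does every real symmetric `(3,4)` pencil on `d` whose net has a really
split annihilator pencil (classes R4 / R0, generic).  Nothing is claimed about the complementary sectors (class R2: one real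
generalised eigenvalue; degenerate nets). [folklore] -/
theorem card_posRoots_le_of_signedEqualDiag_rows (d : Fin 4 → ℕ) {N : ℕ}
    (hrows : ∀ (ε : Fin 3 → ℝ) (δ α β γ : Fin 4 → ℝ), (∀ i, ε i = 1 ∨ ε i = -1) →
      ((Matrix.det (∑ l, ((X : ℝ[X]) ^ d l) •
          (!![ε 0 * δ l, α l, β l; α l, ε 1 * δ l, γ l; β l, γ l, ε 2 * δ l] : Matrix (Fin 3) (Fin 3) ℝ).map C)).roots.toFinset.filter
            (fun t => 0 < t)).card ≤ N)
    (S : Fin 4 → Matrix (Fin 3) (Fin 3) ℝ) (hS : ∀ l, (S l).IsSymm)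
    (B₁ B₂ : Matrix (Fin 3) (Fin 3) ℝ) (hB₁ : B₁.IsSymm) (hB₂ : B₂.IsSymm) (hdet : B₁.det ≠ 0)
    (hann₁ : ∀ l, (B₁ * S l).trace = 0) (hann₂ : ∀ l, (B₂ * S l).trace = 0)
    (μ : Fin 3 → ℝ) (hμ : Function.Injective μ) (hroot : ∀ i, (B₂ - μ i • B₁).det = 0) :
    ((Matrix.det (∑ l, ((X : ℝ[X]) ^ d l) • (S l).map C)).roots.toFinset.filter (fun t => 0 < t)).card ≤ N := by
  obtain ⟨ε, δ, α, β, γ, hε, hcard⟩ :=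
    card_posRoots_eq_signedEqualDiag d S hS B₁ B₂ hB₁ hB₂ hdet hann₁ hann₂ μ hμ hroot
  rw [hcard]
  exact hrows ε δ α β γ hε

/-- The chart letters are symmetric. [folklore] -/
theorem isSymm_signedEqualDiag (e₀ e₁ e₂ α β γ : ℝ) :
    (!![e₀, α, β; α, e₁, γ; β, γ, e₂] : Matrix (Fin 3) (Fin 3) ℝ).IsSymm := by
  refine Matrix.IsSymm.ext fun i j => ?_
  fin_cases i <;> fin_cases j <;> simp

/-- Converse bookkeeping: the row `ζ(3,4; d) ≤ B` (in particular `DoorA34`) contains the signed equal-diagonal rows, since chart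
pencils ARE symmetric pencils. [folklore] -/
theorem signedEqualDiag_rows_of_posRootLawOn (d : Fin 4 → ℕ) {B : ℕ} (h : PosRootLawOn 3 4 B d)
    (ε : Fin 3 → ℝ) (δ α β γ : Fin 4 → ℝ) :
    ((Matrix.det (∑ l, ((X : ℝ[X]) ^ d l) •
        (!![ε 0 * δ l, α l, β l; α l, ε 1 * δ l, γ l; β l, γ l, ε 2 * δ l] : Matrix (Fin 3) (Fin 3) ℝ).map C)).roots.toFinset.filter
          (fun t => 0 < t)).card ≤ B :=
  h _ fun _ => isSymm_signedEqualDiag _ _ _ _ _ _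

/-- In particular under the cell's typed target `DoorA34 = PosRootLawAt 3 4 18` (`Iff.rfl`-equal to the route item
`Theses.LacunarySymmetroid.DoorA34`, stmt-ValiantsHypothesis-19980, `…CensusDoorA34Link`) every signed equal-diagonal pencil has `≤ 18`
distinct positive det-roots on every support (the R4 chart `δ·1 + hollow(α,β,γ)` included). [folklore] -/
theorem signedEqualDiag_rows_of_doorA34 (h : DoorA34)
    (d : Fin 4 → ℕ) (ε : Fin 3 → ℝ) (δ α β γ : Fin 4 → ℝ) :
    ((Matrix.det (∑ l, ((X : ℝ[X]) ^ d l) •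
        (!![ε 0 * δ l, α l, β l; α l, ε 1 * δ l, γ l; β l, γ l, ε 2 * δ l] : Matrix (Fin 3) (Fin 3) ℝ).map C)).roots.toFinset.filter
          (fun t => 0 < t)).card ≤ 18 :=
  h d _ fun _ => isSymm_signedEqualDiag _ _ _ _ _ _

end Summit.ValiantsHypothesis.ValiantsHypothesis.Theorems.LacunarySymmetroidMatrixDescartes.Census.EqualDiagonal
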